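import Summits.CriticalPhenomena.PercolationContinuityZ3.Theorems.Transplant.ProdZ2Paths
import Summits.CriticalPhenomena.PercolationContinuityZ3.Theorems.Transplant.BccSlabStackedKit
import HarnessLib

/-!
# `F □ ℤ²`, p205010-free routing IV: FRAME PATHS — explicit self-avoiding paths of `F □ ℤ²` over the `2 × 3` patch of columns `A + i μ + j ν` of an exceptional
# (stacked) configuration («BccClawXStack».`Frame`), written as lists of triples `(fibre level, i, j)`

builds on p205010 (kernel theorem, internal audit signed; external expert review pending) — NOT used in this file.
Lane `prim-bschramm`, seat `prim-bschramm-p2` (gen 50; class C1b, METHOD = input substitution; memo `HOME/bschramm/P2-LATTICES.md` §161); helper file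
(`--supports stmt-CriticalPhenomena-4575 --as helper`).  Product twin of «BccSlabStackedKit» §1–§2 (there: bcc slab vertices with heights and parities; here:
vertices `(g, A + i μ + j ν)` of `F □ ℤ²`, no parity bookkeeping).
* §1 `fv A μ ν (g, i, j) = (g, fcol A μ ν i j)`, `fpath` (a list of triples as a list of vertices), the step relation `Step F` (an `F`-edge over a fixed column,
  or a unit move of `(i, j)` at a fixed level), `fv_inj`, `fv_adj`, **`gpath_fpath`** (a duplicate-free `Step`-chain of triples is a self-avoiding path),
  `fv_mem_fpath_iff`, `exists_of_mem_col_fcol`, and the region lemma `snd_fv_mem` (patch columns lie in the rerouting region).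
[cite: DuminilCopinSidoraviciusTassion2016, §2.3 (proof of Fact 2: the three disjoint self-avoiding paths in B̄_R(z))]
-/

noncomputable section

namespace Summit.CriticalPhenomena.PercolationContinuityZ3.Theorems.Transplant

namespace FinProdZ2

open Literature.Probability.Percolation Literature.Probability.LatticeModels SimpleGraph BccClawX
open scoped Classical

variable {W : Type} (F : SimpleGraph W)

/-! ## §1 Frame vertices and frame paths of `F □ ℤ²` -/

omit F in
/-- **The frame vertex** of the triple `(g, i, j)`: fibre level `g` over the frame column `A + i μ + j ν`. [folklore] -/
def fv (A : Site 2) (μ ν : Pt) (t : W × ℤ × ℤ) : W × Site 2 := (t.1, fcol A μ ν t.2.1 t.2.2)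

omit F in
/-- **The frame path** of a list of triples. [folklore] -/
def fpath (A : Site 2) (μ ν : Pt) (ts : List (W × ℤ × ℤ)) : List (W × Site 2) := ts.map (fv A μ ν)

omit F in
/-- The column of a frame vertex. [folklore] -/
@[simp] theorem fv_snd (A : Site 2) (μ ν : Pt) (t : W × ℤ × ℤ) : (fv A μ ν t).2 = fcol A μ ν t.2.1 t.2.2 := rfl

omit F in
/-- The level of a frame vertex. [folklore] -/
@[simp] theorem fv_fst (A : Site 2) (μ ν : Pt) (t : W × ℤ × ℤ) : (fv A μ ν t).1 = t.1 := rfl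

omit F in
/-- A frame path written out. [folklore] -/
@[simp] theorem fpath_cons (A : Site 2) (μ ν : Pt) (t : W × ℤ × ℤ) (ts : List (W × ℤ × ℤ)) :
    fpath A μ ν (t :: ts) = fv A μ ν t :: fpath A μ ν ts := rfl

omit F in
/-- The empty frame path. [folklore] -/
@[simp] theorem fpath_nil (A : Site 2) (μ ν : Pt) : fpath A μ ν ([] : List (W × ℤ × ℤ)) = [] := rfl

/-- **The step relation on triples**: an `F`-edge over a fixed frame column, or a unit move of the column coefficients at a fixed fibre level. [folklore] -/
def Step (t t' : W × ℤ × ℤ) : Prop :=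
  (F.Adj t.1 t'.1 ∧ t'.2 = t.2) ∨
    (t'.1 = t.1 ∧ ((t'.2.1 = t.2.1 ∧ (t'.2.2 = t.2.2 + 1 ∨ t.2.2 = t'.2.2 + 1)) ∨ (t'.2.2 = t.2.2 ∧ (t'.2.1 = t.2.1 + 1 ∨ t.2.1 = t'.2.1 + 1))))

/-- A fibre step. [folklore] -/
theorem Step.fibre {g g' : W} (h : F.Adj g g') (i j : ℤ) : Step F (g, i, j) (g', i, j) := Or.inl ⟨h, rfl⟩

/-- A planar step (the coefficient condition is decided by `norm_num` at call sites). [folklore] -/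
theorem Step.planar (g : W) {i j i' j' : ℤ} (hc : (i' = i ∧ (j' = j + 1 ∨ j = j' + 1)) ∨ (j' = j ∧ (i' = i + 1 ∨ i = i' + 1))) :
    Step F (g, i, j) (g, i', j') := Or.inr ⟨rfl, hc⟩

section Frame

variable {F} {RP : Set (Site 2)} {A : Site 2} {μ ν : Pt} (Fr : Frame RP A μ ν)
include Fr

/-- **Injectivity of frame vertices.** [folklore] -/
theorem fv_inj {t t' : W × ℤ × ℤ} (e : fv A μ ν t = fv A μ ν t') : t = t' := by
  obtain ⟨e1, e2⟩ := Prod.mk.inj e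
  obtain ⟨hi, hj⟩ := fcol_inj Fr.hμ Fr.hν Fr.hperp e2
  exact Prod.ext e1 (Prod.ext hi hj)

/-- Columns of distinct coefficient pairs differ. [folklore] -/
theorem fcol_ne_of_ne {i j i' j' : ℤ} (h : (i, j) ≠ (i', j')) : fcol A μ ν i j ≠ fcol A μ ν i' j' := by
  intro e
  obtain ⟨hi, hj⟩ := fcol_inj Fr.hμ Fr.hν Fr.hperp e
  exact h (Prod.ext hi hj)

/-- **Adjacency of frame vertices along a step.** [folklore] -/
theorem fv_adj {t t' : W × ℤ × ℤ} (h : Step F t t') : (F □ zdGraph 2).Adj (fv A μ ν t) (fv A μ ν t') := by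
  rw [boxProd_adj]
  rcases h with ⟨ha, he⟩ | ⟨he, hc⟩
  · left
    refine ⟨ha, ?_⟩
    show fcol A μ ν t.2.1 t.2.2 = fcol A μ ν t'.2.1 t'.2.2
    rw [he]
  · right
    exact ⟨Fr.fcol_adj hc, he.symm⟩

/-- Membership of a frame vertex in a frame path is membership of its triple. [folklore] -/
theorem fv_mem_fpath_iff {t : W × ℤ × ℤ} {ts : List (W × ℤ × ℤ)} : fv A μ ν t ∈ fpath A μ ν ts ↔ t ∈ ts := by
  rw [fpath, List.mem_map]
  constructor
  · rintro ⟨t', ht', he⟩; rwa [← fv_inj Fr he]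
  · intro ht; exact ⟨t, ht, rfl⟩

omit Fr in
/-- A vertex of a frame path is the frame vertex of one of its triples. [folklore] -/
theorem exists_of_mem_fpath {x : W × Site 2} {ts : List (W × ℤ × ℤ)} (hx : x ∈ fpath A μ ν ts) : ∃ t ∈ ts, fv A μ ν t = x := List.mem_map.1 hx

omit Fr in
/-- A vertex of a column path over a frame column is a frame vertex with those coefficients. [folklore] -/
theorem exists_of_mem_col_fcol {x : W × Site 2} {i j : ℤ} {L : List W} (hx : x ∈ col (fcol A μ ν i j) L) : ∃ f ∈ L, fv A μ ν (f, i, j) = x := by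
  obtain ⟨hf, hq⟩ := mem_col.1 hx
  exact ⟨x.1, hf, Prod.ext rfl hq.symm⟩

/-- **A frame path is a self-avoiding path of `F □ ℤ²`** when its triples are pairwise distinct and consecutive ones make a `Step`. [folklore] -/
theorem gpath_fpath {ts : List (W × ℤ × ℤ)} (hne : ts ≠ []) (hnd : ts.Nodup) (hch : ts.IsChain (Step F)) :
    GPath (F □ zdGraph 2) (fpath A μ ν ts) (fv A μ ν (ts.head hne)) (fv A μ ν (ts.getLast hne)) := by
  have hne' : fpath A μ ν ts ≠ [] := by simpa [fpath] using hne
  refine ⟨hne', ?_, ?_, ?_, ?_⟩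
  · exact BccSlab.isChain_map_of_mem (fun a _ b _ hab => fv_adj Fr hab) hch
  · rw [fpath]
    exact hnd.map_on fun a _ b _ hab => fv_inj Fr hab
  · rw [fpath, List.head?_map, List.head?_eq_some_head hne]; rfl
  · rw [fpath, List.getLast?_map, List.getLast?_eq_some_getLast hne]; rfl

/-- **Patch columns lie in the rerouting region**: `0 ≤ i ≤ 1`, `0 ≤ j ≤ 2`. [folklore] -/
theorem snd_fv_mem {t : W × ℤ × ℤ} (h : 0 ≤ t.2.1 ∧ t.2.1 ≤ 1 ∧ 0 ≤ t.2.2 ∧ t.2.2 ≤ 2) : (fv A μ ν t).2 ∈ RP :=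
  Fr.hreg t.2.1 t.2.2 h.1 h.2.1 h.2.2.1 h.2.2.2

/-- All vertices of a frame path over the patch lie over the rerouting region. [folklore] -/
theorem snd_mem_of_mem_fpath {ts : List (W × ℤ × ℤ)} (hts : ∀ t ∈ ts, 0 ≤ t.2.1 ∧ t.2.1 ≤ 1 ∧ 0 ≤ t.2.2 ∧ t.2.2 ≤ 2) {x : W × Site 2}
    (hx : x ∈ fpath A μ ν ts) : x.2 ∈ RP := by
  obtain ⟨t, ht, rfl⟩ := exists_of_mem_fpath hx
  exact snd_fv_mem Fr (hts t ht)

/-- A column path over a patch column lies over the rerouting region. [folklore] -/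
theorem snd_mem_of_mem_col {i j : ℤ} (h : 0 ≤ i ∧ i ≤ 1 ∧ 0 ≤ j ∧ j ≤ 2) {L : List W} {x : W × Site 2} (hx : x ∈ col (fcol A μ ν i j) L) : x.2 ∈ RP := by
  obtain ⟨f, -, rfl⟩ := exists_of_mem_col_fcol hx
  exact snd_fv_mem Fr h

/-- **A column path over a frame column, prefixed by frame vertices**: `fv t :: col (fcol i j) L` is a self-avoiding path when `t` steps to the head of the
column path and `t` is not over that column. [folklore] -/
theorem gpath_cons_col {t : W × ℤ × ℤ} {i j : ℤ} {L : List W} {x y : W} (hL : GPath F L x y) (hs : Step F t (x, i, j))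
    (ht : t.2 ≠ (i, j)) : GPath (F □ zdGraph 2) (fv A μ ν t :: col (fcol A μ ν i j) L) (fv A μ ν t) (y, fcol A μ ν i j) := by
  refine (gpath_col F hL).cons (fv_adj Fr hs) fun hmem => ?_
  obtain ⟨f, -, he⟩ := exists_of_mem_col_fcol hmem
  have := fv_inj Fr he
  exact ht (by rw [← this])

end Frame

end FinProdZ2

end Summit.CriticalPhenomena.PercolationContinuityZ3.Theorems.Transplant

end
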